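import Summits.CriticalPhenomena.PercolationContinuityZ3.Theorems.PercNearOneGluingNoHeavyLowerTailSunflowerMultiPetalKempeMarkedHeart
import HarnessLib
import HarnessLib.Audit

/-!
# `NoHeavyLowerTail` (crux stmt-CriticalPhenomena-4575), marked-multigraph layer: the UNPAIRED neighbourhood step law (cell heart)

Support file (seat `prim-l12-p2` gen 54; `--supports stmt-CriticalPhenomena-4575`; continuation of `…KempeMarkedHeart` (p596349)).
No `sorry`; nothing is asserted about the crux.  Memo: run/shared/lean/prim/prim-l12/prim-l12-p2/FINDING-g54-UNPAIRED-ALL-D-LAW.md §1–§2.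

WHAT.  THEOREM L1 of gen 47 (`TfunM_step`, `sum_resCell_nonneg`) proves the step `T(K) ≥ T(K−y) + T((K−y)/(S∪u → u))` by PAIRING every row with
its image under the colour swap `Φ_u`.  The transfer of step laws to the fractional-mark hierarchy `TI_{P,Q}` (memo FINDING-g53 §1) needs laws that are
row-positive WITHOUT pairing.  This file proves the cell heart of such a law, valid for every outer degree `|S| ≥ 2` when `y ≁ v`:
`T(K) ≥ T(K') + T(K'/(S∪u)) + T((K'/S)⁺ᵘ) + ½ Σ_{s ∈ S} T(K'/((S∖s)∪u → u)/(s∪v → v))`, `K' = K − y`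
(memo §1: the two new kernels — the `u`-marked contraction of the whole block `S`, and the `d` double merges — neutralise the deficits D1, D2, D5 of
gen 47 inside their own cells; D4 is paid by its sibling cell as in gen 47).  In cell language, with `t = type_{K−y} ρ`, `k = profile_y ρ`:
`resU2 ρ = 2·resCell ρ − 2·[ρ constant on S]·fC(t ⊕ e₀) − Σ_{s∈S} [ρ s = 1, ρ ≡ 0 on S∖s]·fC t`, and
* `sum_resU2_eq`: `Σ_ρ resU2 = 2·(3·T(K) − T(K.isolate y) − allZeroSum) − 2·blockSum − Σ_s uvSum s`;
* `sum_resU2_nonneg` (**the heart**, `|S| ≥ 2`, `mul y v = 0`): `0 ≤ Σ_ρ resU2` — every cell is `≥ 0` by five finite tables except the D4 cells (value `−2`),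
  which are charged injectively to their sibling cells (value `≥ 2`, `resCell_sibling_of_D4`);
* `unpaired_cell_ineq`: `2·T(K.isolate y) + 2·allZeroSum + 2·blockSum + Σ_s uvSum s ≤ 6·T(K)`.
The identification of `blockSum`, `uvSum` with `T` of actual minors (and the graph-level law) is the sequel `…KempeMarkedUnpairedStep`.
-/

namespace Summit.CriticalPhenomena.PercolationContinuityZ3.Theorems.SunflowerPartition.Kempe

open Finset

/-! ## Finite tables (the five cell inequalities of the unpaired law) -/

/-- All-`2` cells: `2·kerTAbs t (a,0,2) − 2·fC(t ⊕ e₀) ≥ 0` for `a ≠ 0` (the `u`-marked block kernel reproduces the cell exactly when `a = 1`). [this work] -/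
theorem unpaired_table_all2 : ∀ (t : CType) (a : Fin 3), a ≠ 0 → 0 ≤ 2 * kerTAbs t (a, 0, 2) - 2 * fC (ctAdd t (1, 0, 0)) := by decide

/-- All-`1` cells: `2·kerTAbs t (a,2,0) − 2·fC(t ⊕ e₀) ≥ 0` for `a ≠ 0`. [this work] -/
theorem unpaired_table_all1 : ∀ (t : CType) (a : Fin 3), a ≠ 0 → 0 ≤ 2 * kerTAbs t (a, 2, 0) - 2 * fC (ctAdd t (1, 0, 0)) := by decide

/-- All-`0` cells: `2·(kerTAbs t (2,0,0) − fC t) − 2·fC(t ⊕ e₀) = 2·(fC(t ⊕ 2e₀) − fC(t ⊕ e₀)) ≥ 0`. [this work] -/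
theorem unpaired_table_all0 : ∀ t : CType, 0 ≤ 2 * (kerTAbs t (2, 0, 0) - fC t) - 2 * fC (ctAdd t (1, 0, 0)) := by decide

/-- Double-merge cells (`s ↦ 1`, rest of `S ↦ 0`): `2·kerTAbs t (2,b,0) − fC t ≥ 0` for `b ≠ 0` (this neutralises the D5 deficit at `t = 001`). [this work] -/
theorem unpaired_table_uv : ∀ (t : CType) (b : Fin 3), b ≠ 0 → 0 ≤ 2 * kerTAbs t (2, b, 0) - fC t := by decide

/-- `fC ≤ 2`. [this work] -/
theorem fC_le_two : ∀ t : CType, fC t ≤ 2 := by decide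

/-- `cap3 0 = 0`. [this work] -/
theorem cap3_zero : cap3 0 = 0 := ((eq_zero_iff_cap3 0).1 rfl).symm

namespace MGraph

variable {V : Type*} [Fintype V] [LinearOrder V] (K : MGraph V)

/-! ## The unpaired cell residual and its kernel sums -/

section Unpaired

variable (y : V) (S : Finset V)

/-- Twice the UNPAIRED cell residual: `2·resCell ρ − 2·[ρ constant on S]·fC(type_{K−y} ρ ⊕ e₀) − Σ_{s∈S} [ρ s = 1 ∧ ρ ≡ 0 on S∖{s}]·fC(type_{K−y} ρ)`. [this work] -/
def resU2 (ρ : V → Fin 3) : ℤ :=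
  2 * K.resCell y S ρ
    - 2 * (if (∀ s ∈ S, ρ s = 0) ∨ (∀ s ∈ S, ρ s = 1) ∨ (∀ s ∈ S, ρ s = 2) then fC (ctAdd ((K.isolate y).ctypeM ρ) (1, 0, 0)) else 0)
    - ∑ s ∈ S, (if ρ s = 1 ∧ (∀ s' ∈ S, s' ≠ s → ρ s' = 0) then fC ((K.isolate y).ctypeM ρ) else 0)

/-- The BLOCK-KERNEL cell sum: `Σ_{ρ u = 0, ρ v = 1} [ρ constant on S]·fC(type_{K−y} ρ ⊕ e₀)` (up to free-vertex factors, `T` of `(K−y)/S` with one extra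
mark at `u`; sequel). [this work] -/
def blockSum (u v : V) : ℤ :=
  ∑ ρ ∈ univ.filter (fun ρ : V → Fin 3 => ρ u = 0 ∧ ρ v = 1),
    (if (∀ s ∈ S, ρ s = 0) ∨ (∀ s ∈ S, ρ s = 1) ∨ (∀ s ∈ S, ρ s = 2) then fC (ctAdd ((K.isolate y).ctypeM ρ) (1, 0, 0)) else 0)

/-- The DOUBLE-MERGE cell sum at `s`: `Σ_{ρ u = 0, ρ v = 1} [ρ s = 1 ∧ ρ ≡ 0 on S∖{s}]·fC(type_{K−y} ρ)` (up to free-vertex factors, `T` of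
`(K−y)/((S∖s)∪u → u)/(s∪v → v)`; sequel). [this work] -/
def uvSum (s u v : V) : ℤ :=
  ∑ ρ ∈ univ.filter (fun ρ : V → Fin 3 => ρ u = 0 ∧ ρ v = 1),
    (if ρ s = 1 ∧ (∀ s' ∈ S, s' ≠ s → ρ s' = 0) then fC ((K.isolate y).ctypeM ρ) else 0)

/-- **THE UNPAIRED CELL IDENTITY**: `Σ_ρ resU2 = 2·(3·T(K) − T(K.isolate y) − allZeroSum) − 2·blockSum − Σ_{s∈S} uvSum s`. [this work] -/
theorem sum_resU2_eq (u v : ({y}ᶜ : Set V)) :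
    ∑ ρ ∈ univ.filter (fun ρ : V → Fin 3 => ρ u.1 = 0 ∧ ρ v.1 = 1), K.resU2 y S ρ
      = 2 * ((3 * K.TfunM u.1 v.1 - (K.isolate y).TfunM u.1 v.1) - K.allZeroSum y S u.1 v.1)
        - 2 * K.blockSum y S u.1 v.1 - ∑ s ∈ S, K.uvSum y S s u.1 v.1 := by
  unfold resU2 blockSum uvSum
  rw [sum_sub_distrib, sum_sub_distrib, ← mul_sum, ← mul_sum, K.sum_resCell_eq y S u v, sum_comm]

end Unpaired

/-! ## The heart: nonnegativity of the unpaired row sums (`|S| ≥ 2`, `y ≁ v`) -/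

section UnpairedHeart

variable {K}
variable {u v y : V} {S : Finset V}

/-- The profile of `y` in terms of the colouring of `S` (terminal colours at `u`, `v`; `y` unmarked). [this work] -/
theorem profM_eq_sums (hS : ∀ w, w ∈ S ↔ (w ≠ u ∧ w ≠ v ∧ w ≠ y ∧ K.mul y w ≠ 0)) (huv : u ≠ v) (hyu : y ≠ u) (hyv : y ≠ v)
    (hmy : K.mark y = 0) (ρ : V → Fin 3) (hu : ρ u = 0) (hv : ρ v = 1) :
    K.profM y ρ = (cap3 (K.mul y u + ∑ s ∈ S, (if ρ s = 0 then K.mul y s else 0)),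
      cap3 (K.mul y v + ∑ s ∈ S, (if ρ s = 1 then K.mul y s else 0)), cap3 (∑ s ∈ S, (if ρ s = 2 then K.mul y s else 0))) := by
  unfold profM
  rw [linkM_eq_outer hS huv hyu hyv ρ 0, linkM_eq_outer hS huv hyu hyv ρ 1, linkM_eq_outer hS huv hyu hyv ρ 2, hu, hv, hmy]
  have h10 : ¬((1 : Fin 3) = 0) := by decide
  have h01 : ¬((0 : Fin 3) = 1) := by decide
  have h02 : ¬((0 : Fin 3) = 2) := by decide
  have h12 : ¬((1 : Fin 3) = 2) := by decide
  simp only [if_true, if_false, h10, h01, h02, h12, add_zero, zero_add]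

omit [Fintype V] [LinearOrder V] in
/-- In an all-`c` cell (`|S| ≥ 2`) the `c`-sum over `S` is saturated and the other two `S`-sums vanish. [this work] -/
theorem sums_of_all (hS : ∀ w, w ∈ S ↔ (w ≠ u ∧ w ≠ v ∧ w ≠ y ∧ K.mul y w ≠ 0)) (htwo : 2 ≤ S.card) (ρ : V → Fin 3) (c : Fin 3)
    (hall : ∀ s ∈ S, ρ s = c) :
    cap3 (∑ s ∈ S, (if ρ s = c then K.mul y s else 0)) = 2 ∧ ∀ d : Fin 3, d ≠ c → (∑ s ∈ S, (if ρ s = d then K.mul y s else 0)) = 0 := by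
  refine ⟨?_, fun d hd => ?_⟩
  · have := card_le_sumS hS ρ c hall
    rw [← two_le_iff_cap3]; omega
  · exact (sumS_eq_zero_iff hS ρ d).2 fun s hs h => hd (by rw [← h, hall s hs])

/-- **Cell values of the unpaired law.**  With `|S| ≥ 2`, `mul y v = 0`, `y ∼ u` unmarked: every terminal-coloured cell has `resU2 ≥ 0`, except the D4 cells
(`S ≡ 0` but one simply-joined `s₀ ↦ 2`, type `010`), where `resU2 = −2`. [this work] -/
theorem resU2_neg_cases (hS : ∀ w, w ∈ S ↔ (w ≠ u ∧ w ≠ v ∧ w ≠ y ∧ K.mul y w ≠ 0)) (huv : u ≠ v) (hyu : y ≠ u) (hyv : y ≠ v)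
    (hmy : K.mark y = 0) (hyu' : K.mul y u ≠ 0) (hv0 : K.mul y v = 0) (htwo : 2 ≤ S.card) (ρ : V → Fin 3) (hu : ρ u = 0) (hv : ρ v = 1)
    (hneg : K.resU2 y S ρ < 0) :
    (∃ s₀ ∈ S, ρ s₀ = 2 ∧ K.mul y s₀ = 1 ∧ (∀ s ∈ S, s ≠ s₀ → ρ s = 0) ∧ K.mul y v = 0 ∧ (K.isolate y).ctypeM ρ = (0, 1, 0)) ∧
      K.resU2 y S ρ = -2 := by
  have hne : S.Nonempty := card_pos.1 (by omega)
  have two : ∀ s₀ ∈ S, ∃ s ∈ S, s ≠ s₀ := fun s₀ _ => by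
    by_contra hno; push Not at hno
    have : S.card ≤ 1 := card_le_one.2 fun a ha b hb => by rw [hno a ha, hno b hb]
    omega
  have hprof := profM_eq_sums hS huv hyu hyv hmy ρ hu hv
  have hmu : cap3 (K.mul y u) ≠ 0 := fun h => hyu' ((eq_zero_iff_cap3 _).2 h)
  set t := (K.isolate y).ctypeM ρ with ht
  -- the three constant patterns and the double-merge pattern have nonnegative residual
  by_cases hconst : (∀ s ∈ S, ρ s = 0) ∨ (∀ s ∈ S, ρ s = 1) ∨ (∀ s ∈ S, ρ s = 2)
  · exfalso
    have hnoUV : ∀ s ∈ S, ¬(ρ s = 1 ∧ (∀ s' ∈ S, s' ≠ s → ρ s' = 0)) := by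
      intro s hs ⟨h1, hrest⟩
      obtain ⟨s', hs', hne'⟩ := two s hs
      have h0 := hrest s' hs' hne'
      rcases hconst with h | h | h
      · rw [h s hs] at h1; exact absurd h1 (by decide)
      · rw [h s' hs'] at h0; exact absurd h0 (by decide)
      · rw [h s hs] at h1; exact absurd h1 (by decide)
    have hUV0 : ∑ s ∈ S, (if ρ s = 1 ∧ (∀ s' ∈ S, s' ≠ s → ρ s' = 0) then fC t else 0) = 0 :=
      sum_eq_zero fun s hs => if_neg (hnoUV s hs)
    have hval : K.resU2 y S ρ = 2 * K.resCell y S ρ - 2 * fC (ctAdd t (1, 0, 0)) := by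
      unfold resU2; rw [if_pos hconst, ← ht, hUV0, sub_zero]
    rcases hconst with hall | hall | hall
    · -- all 0: profile (2,0,0), resCell = kerTAbs − fC
      obtain ⟨h0, hoth⟩ := sums_of_all hS htwo ρ 0 hall
      have hk : K.profM y ρ = (2, 0, 0) := by
        rw [hprof, hoth 1 (by decide), hoth 2 (by decide), hv0, add_zero, cap3_zero]
        refine Prod.ext ?_ rfl
        have : S.card ≤ K.mul y u + ∑ s ∈ S, (if ρ s = 0 then K.mul y s else 0) := le_add_left (card_le_sumS hS ρ 0 hall)
        exact (two_le_iff_cap3 _).1 (by omega)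
      have hres : K.resCell y S ρ = kerTAbs t (2, 0, 0) - fC t := by
        unfold resCell; rw [if_pos hall, hk, ← ht]
      have := unpaired_table_all0 t
      rw [hval, hres] at hneg; omega
    · -- all 1: profile (a,2,0)
      obtain ⟨h1, hoth⟩ := sums_of_all hS htwo ρ 1 hall
      have hk : K.profM y ρ = (cap3 (K.mul y u), 2, 0) := by
        rw [hprof, hoth 0 (by decide), hoth 2 (by decide), hv0, add_zero, zero_add, cap3_zero, h1]
      have hnot : ¬(∀ s ∈ S, ρ s = 0) := by
        obtain ⟨s, hs⟩ := hne; intro hh; have := hh s hs; rw [hall s hs] at this; exact absurd this (by decide)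
      have hres : K.resCell y S ρ = kerTAbs t (cap3 (K.mul y u), 2, 0) := by
        unfold resCell; rw [if_neg hnot, sub_zero, hk, ← ht]
      have := unpaired_table_all1 t _ hmu
      rw [hval, hres] at hneg; omega
    · -- all 2: profile (a,0,2)
      obtain ⟨h2, hoth⟩ := sums_of_all hS htwo ρ 2 hall
      have hk : K.profM y ρ = (cap3 (K.mul y u), 0, 2) := by
        rw [hprof, hoth 0 (by decide), hoth 1 (by decide), hv0, add_zero, zero_add, cap3_zero, h2]
      have hnot : ¬(∀ s ∈ S, ρ s = 0) := by
        obtain ⟨s, hs⟩ := hne; intro hh; have := hh s hs; rw [hall s hs] at this; exact absurd this (by decide)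
      have hres : K.resCell y S ρ = kerTAbs t (cap3 (K.mul y u), 0, 2) := by
        unfold resCell; rw [if_neg hnot, sub_zero, hk, ← ht]
      have := unpaired_table_all2 t _ hmu
      rw [hval, hres] at hneg; omega
  · by_cases hUV : ∃ s ∈ S, ρ s = 1 ∧ (∀ s' ∈ S, s' ≠ s → ρ s' = 0)
    · exfalso
      obtain ⟨s, hs, h1, hrest⟩ := hUV
      -- exactly one double-merge term fires
      have hsum : ∑ s' ∈ S, (if ρ s' = 1 ∧ (∀ s'' ∈ S, s'' ≠ s' → ρ s'' = 0) then fC t else 0) = fC t := by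
        rw [sum_eq_single_of_mem s hs (fun s' hs' hne' => ?_), if_pos ⟨h1, hrest⟩]
        have : ρ s' = 0 := hrest s' hs' hne'
        rw [if_neg (fun h => by rw [this] at h; exact absurd h.1 (by decide))]
      have hnot : ¬(∀ s' ∈ S, ρ s' = 0) := fun hh => by have := hh s hs; rw [h1] at this; exact absurd this (by decide)
      -- profile (2, cap (mul y s), 0)
      have hA0 : 2 ≤ K.mul y u + ∑ s' ∈ S, (if ρ s' = 0 then K.mul y s' else 0) := by
        obtain ⟨s', hs', hne'⟩ := two s hs
        have hle := single_le_sum (f := fun s' => if ρ s' = 0 then K.mul y s' else 0) (fun _ _ => Nat.zero_le _) hs'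
        simp only [hrest s' hs' hne', if_true] at hle
        have a := Nat.one_le_iff_ne_zero.2 hyu'
        have b := Nat.one_le_iff_ne_zero.2 ((hS s').1 hs').2.2.2
        omega
      have hA1 : ∑ s' ∈ S, (if ρ s' = 1 then K.mul y s' else 0) = K.mul y s := by
        rw [sum_eq_single_of_mem s hs (fun s' hs' hne' => by rw [if_neg (by rw [hrest s' hs' hne']; decide)]), if_pos h1]
      have hA2 : ∑ s' ∈ S, (if ρ s' = 2 then K.mul y s' else 0) = 0 :=
        (sumS_eq_zero_iff hS ρ 2).2 fun s' hs' h => by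
          by_cases hne' : s' = s
          · rw [hne', h1] at h; exact absurd h (by decide)
          · rw [hrest s' hs' hne'] at h; exact absurd h (by decide)
      have hk : K.profM y ρ = (2, cap3 (K.mul y s), 0) := by
        rw [hprof, hA1, hA2, hv0, zero_add, cap3_zero, (two_le_iff_cap3 _).1 hA0]
      have hms : cap3 (K.mul y s) ≠ 0 := fun h => ((hS s).1 hs).2.2.2 ((eq_zero_iff_cap3 _).2 h)
      have hval : K.resU2 y S ρ = 2 * kerTAbs t (2, cap3 (K.mul y s), 0) - fC t := by
        unfold resU2 resCell; rw [if_neg hconst, if_neg hnot, sub_zero, hk, ← ht, hsum]; ring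
      have := unpaired_table_uv t _ hms
      rw [hval] at hneg; omega
    · -- generic cell: resU2 = 2·resCell, so resCell < 0 and the deficit classification applies
      have hUV0 : ∑ s ∈ S, (if ρ s = 1 ∧ (∀ s' ∈ S, s' ≠ s → ρ s' = 0) then fC t else 0) = 0 :=
        sum_eq_zero fun s hs => if_neg (fun h => hUV ⟨s, hs, h⟩)
      have hval : K.resU2 y S ρ = 2 * K.resCell y S ρ := by
        unfold resU2; rw [if_neg hconst, ← ht, hUV0]; ring
      have hneg' : K.resCell y S ρ < 0 := by rw [hval] at hneg; omega
      have hm1 := resCell_eq_neg_one_of_neg hS huv hyu hyv hmy hyu' htwo ρ hu hv hneg'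
      rcases resCell_neg_cases hS huv hyu hyv hmy hyu' htwo ρ hu hv hneg' with
        ⟨hall, -, -, -⟩ | ⟨hall, -, -⟩ | ⟨s₀, hs₀, hc₀, hm₀, hrest, hv0', ht'⟩ | ⟨s₀, hs₀, hc₀, -, hrest, -, -⟩
      · exact absurd (Or.inr (Or.inr hall)) hconst
      · exact absurd (Or.inr (Or.inl hall)) hconst
      · exact ⟨⟨s₀, hs₀, hc₀, hm₀, hrest, hv0', ht'⟩, by rw [hval, hm1]; rfl⟩
      · exact absurd ⟨s₀, hs₀, hc₀, hrest⟩ hUV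

/-- **Payer**: the sibling `ρ[s₀ ↦ 1]` of a D4 cell has `resU2 ≥ 2` (its `resCell` is `2` by `resCell_sibling_of_D4`; it is a double-merge cell, charged
at most `fC ≤ 2`, and not a constant cell). [this work] -/
theorem two_le_resU2_sibling_of_D4 (hS : ∀ w, w ∈ S ↔ (w ≠ u ∧ w ≠ v ∧ w ≠ y ∧ K.mul y w ≠ 0)) (huv : u ≠ v) (hyu : y ≠ u) (hyv : y ≠ v)
    (hmy : K.mark y = 0) (hyu' : K.mul y u ≠ 0) (htwo : 2 ≤ S.card) (ρ : V → Fin 3) (hu : ρ u = 0) (hv : ρ v = 1)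
    {s₀ : V} (hs₀ : s₀ ∈ S) (hc₀ : ρ s₀ = 2) (hm₀ : K.mul y s₀ = 1) (hrest : ∀ s ∈ S, s ≠ s₀ → ρ s = 0) (hv0 : K.mul y v = 0)
    (ht : (K.isolate y).ctypeM ρ = (0, 1, 0)) :
    2 ≤ K.resU2 y S (Function.update ρ s₀ 1) := by
  set σ := Function.update ρ s₀ 1 with hσ
  have two : ∃ s ∈ S, s ≠ s₀ := by
    by_contra hno; push Not at hno
    have : S.card ≤ 1 := card_le_one.2 fun a ha b hb => by rw [hno a ha, hno b hb]
    omega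
  have hσ₀ : σ s₀ = 1 := by rw [hσ, Function.update_self]
  have hσr : ∀ s ∈ S, s ≠ s₀ → σ s = 0 := fun s hs hne => by rw [hσ, Function.update_of_ne hne, hrest s hs hne]
  have hres := resCell_sibling_of_D4 hS huv hyu hyv hmy hyu' htwo ρ hu hv hs₀ hc₀ hm₀ hrest hv0 ht
  have hconst : ¬((∀ s ∈ S, σ s = 0) ∨ (∀ s ∈ S, σ s = 1) ∨ (∀ s ∈ S, σ s = 2)) := by
    obtain ⟨s', hs', hne'⟩ := two
    rintro (h | h | h)
    · have := h s₀ hs₀; rw [hσ₀] at this; exact absurd this (by decide)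
    · have := h s' hs'; rw [hσr s' hs' hne'] at this; exact absurd this (by decide)
    · have := h s₀ hs₀; rw [hσ₀] at this; exact absurd this (by decide)
  set t := (K.isolate y).ctypeM σ with ht'
  have hsum : ∑ s ∈ S, (if σ s = 1 ∧ (∀ s' ∈ S, s' ≠ s → σ s' = 0) then fC t else 0) = fC t := by
    rw [sum_eq_single_of_mem s₀ hs₀ (fun s' hs' hne' => ?_), if_pos ⟨hσ₀, hσr⟩]
    have : σ s' = 0 := hσr s' hs' hne'
    rw [if_neg (fun h => by rw [this] at h; exact absurd h.1 (by decide))]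
  have hval : K.resU2 y S σ = 2 * K.resCell y S σ - fC t := by
    unfold resU2; rw [if_neg hconst, ← ht', hsum]; ring
  rw [hval, hres]
  have := fC_le_two t
  omega

/-- The sibling map on cells: recolour the (first) `2`-coloured vertex of `S` to `1`. [this work] -/
noncomputable def sibU (S : Finset V) (ρ : V → Fin 3) : V → Fin 3 :=
  if h : ∃ s ∈ S, ρ s = 2 then Function.update ρ (Classical.choose h) 1 else ρ

omit [Fintype V] in
/-- On a cell with a unique `2` on `S` at `s₀`, `sibU` recolours `s₀`. [this work] -/
theorem sibU_of_D4 (ρ : V → Fin 3) {s₀ : V} (hs₀ : s₀ ∈ S) (hc₀ : ρ s₀ = 2) (hrest : ∀ s ∈ S, s ≠ s₀ → ρ s = 0) :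
    sibU S ρ = Function.update ρ s₀ 1 := by
  have h : ∃ s ∈ S, ρ s = 2 := ⟨s₀, hs₀, hc₀⟩
  unfold sibU
  rw [dif_pos h]
  have hspec := Classical.choose_spec h
  have heq : Classical.choose h = s₀ := by
    by_contra hne
    have := hrest _ hspec.1 hne
    rw [hspec.2] at this; exact absurd this (by decide)
  rw [heq]

/-- **THE HEART OF THE UNPAIRED LAW** (memo §1; `|S| ≥ 2`, `y ≁ v`): the unpaired cell residuals sum to a nonnegative number — no pairing of rows is used;
the only non-local step is the in-row charge of each D4 cell to its sibling. [this work] -/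
theorem sum_resU2_nonneg (hS : ∀ w, w ∈ S ↔ (w ≠ u ∧ w ≠ v ∧ w ≠ y ∧ K.mul y w ≠ 0)) (huv : u ≠ v) (hyu : y ≠ u) (hyv : y ≠ v)
    (hmy : K.mark y = 0) (hyu' : K.mul y u ≠ 0) (hv0 : K.mul y v = 0) (htwo : 2 ≤ S.card) :
    0 ≤ ∑ ρ ∈ univ.filter (fun ρ : V → Fin 3 => ρ u = 0 ∧ ρ v = 1), K.resU2 y S ρ := by
  set F := univ.filter (fun ρ : V → Fin 3 => ρ u = 0 ∧ ρ v = 1) with hF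
  set D := F.filter (fun ρ => K.resU2 y S ρ < 0) with hD
  have memF : ∀ ρ, ρ ∈ F ↔ ρ u = 0 ∧ ρ v = 1 := fun ρ => by rw [hF, mem_filter]; simp
  -- (1) deficit cells are −2 and are D4 cells
  have hDval : ∀ ρ ∈ D, K.resU2 y S ρ = -2 := fun ρ hρ => by
    rw [hD, mem_filter] at hρ
    exact (resU2_neg_cases hS huv hyu hyv hmy hyu' hv0 htwo ρ ((memF ρ).1 hρ.1).1 ((memF ρ).1 hρ.1).2 hρ.2).2
  -- (2) payers
  have hpay : ∀ ρ ∈ D, sibU S ρ ∈ F ∧ 2 ≤ K.resU2 y S (sibU S ρ) := by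
    intro ρ hρ
    rw [hD, mem_filter] at hρ
    obtain ⟨hu, hv⟩ := (memF ρ).1 hρ.1
    obtain ⟨⟨s₀, hs₀, hc₀, hm₀, hrest, -, ht⟩, -⟩ := resU2_neg_cases hS huv hyu hyv hmy hyu' hv0 htwo ρ hu hv hρ.2
    obtain ⟨hs₀u, hs₀v, -, -⟩ := (hS s₀).1 hs₀
    rw [sibU_of_D4 ρ hs₀ hc₀ hrest]
    exact ⟨(memF _).2 ⟨by rw [Function.update_of_ne hs₀u.symm, hu], by rw [Function.update_of_ne hs₀v.symm, hv]⟩,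
      two_le_resU2_sibling_of_D4 hS huv hyu hyv hmy hyu' htwo ρ hu hv hs₀ hc₀ hm₀ hrest hv0 ht⟩
  -- (3) injectivity of the sibling map on D
  have hinj : Set.InjOn (sibU S) D := by
    intro ρ₁ h₁ ρ₂ h₂ heq
    rw [mem_coe, hD, mem_filter] at h₁ h₂
    obtain ⟨hu₁, hv₁⟩ := (memF ρ₁).1 h₁.1
    obtain ⟨hu₂, hv₂⟩ := (memF ρ₂).1 h₂.1
    obtain ⟨⟨s₁, hs₁, c₁, -, r₁, -, -⟩, -⟩ := resU2_neg_cases hS huv hyu hyv hmy hyu' hv0 htwo ρ₁ hu₁ hv₁ h₁.2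
    obtain ⟨⟨s₂, hs₂, c₂, -, r₂, -, -⟩, -⟩ := resU2_neg_cases hS huv hyu hyv hmy hyu' hv0 htwo ρ₂ hu₂ hv₂ h₂.2
    rw [sibU_of_D4 ρ₁ hs₁ c₁ r₁, sibU_of_D4 ρ₂ hs₂ c₂ r₂] at heq
    have hs : s₁ = s₂ := by
      by_contra hne
      have h := congrFun heq s₁
      rw [Function.update_self, Function.update_of_ne hne, r₂ s₁ hs₁ hne] at h
      exact absurd h (by decide)
    subst hs
    funext w
    by_cases hw : w = s₁
    · rw [hw, c₁, c₂]
    · have h := congrFun heq w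
      rwa [Function.update_of_ne hw, Function.update_of_ne hw] at h
  -- (4) assembly
  have hDsub : D ⊆ F := filter_subset _ _
  have hsplit : ∑ ρ ∈ F, K.resU2 y S ρ = ∑ ρ ∈ D, K.resU2 y S ρ + ∑ ρ ∈ F \ D, K.resU2 y S ρ := by
    rw [← sum_sdiff hDsub, add_comm]
  have hDsum : ∑ ρ ∈ D, K.resU2 y S ρ = -2 * (D.card : ℤ) := by
    rw [sum_congr rfl hDval, sum_const]; simp; ring
  have himg_sub : D.image (sibU S) ⊆ F \ D := by
    intro σ hσ
    rw [mem_image] at hσ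
    obtain ⟨ρ, hρ, rfl⟩ := hσ
    obtain ⟨hF1, h1⟩ := hpay ρ hρ
    rw [mem_sdiff]
    refine ⟨hF1, fun hmem => ?_⟩
    have hlt : K.resU2 y S (sibU S ρ) < 0 := by
      simp only [hD, mem_filter] at hmem; exact hmem.2
    omega
  have hrest_nonneg : ∀ ρ ∈ F \ D, 0 ≤ K.resU2 y S ρ := fun ρ hρ => by
    have hρF := (mem_sdiff.1 hρ).1
    have hρD := (mem_sdiff.1 hρ).2
    by_contra hlt; push Not at hlt
    exact hρD (by simp only [hD, mem_filter]; exact ⟨hρF, hlt⟩)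
  have h2 : ∑ σ ∈ D.image (sibU S), K.resU2 y S σ ≤ ∑ ρ ∈ F \ D, K.resU2 y S ρ :=
    sum_le_sum_of_subset_of_nonneg himg_sub (fun ρ hρ _ => hrest_nonneg ρ hρ)
  have h3 : 2 * ((D.image (sibU S)).card : ℤ) ≤ ∑ σ ∈ D.image (sibU S), K.resU2 y S σ := by
    rw [card_eq_sum_ones, Nat.cast_sum, mul_sum]
    refine sum_le_sum fun σ hσ => ?_
    rw [mem_image] at hσ
    obtain ⟨ρ, hρ, rfl⟩ := hσ
    simpa using (hpay ρ hρ).2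
  have h4 : (D.image (sibU S)).card = D.card := card_image_of_injOn hinj
  rw [hsplit, hDsum]
  have : 2 * (D.card : ℤ) ≤ ∑ ρ ∈ F \ D, K.resU2 y S ρ := by
    calc 2 * (D.card : ℤ) = 2 * ((D.image (sibU S)).card : ℤ) := by rw [h4]
      _ ≤ _ := h3
      _ ≤ _ := h2
  linarith

/-- **THE UNPAIRED LAW IN CELL FORM** (`|S| ≥ 2`, `y ≁ v`, `y ∼ u` unmarked):
`2·T(K.isolate y) + 2·allZeroSum + 2·blockSum + Σ_{s∈S} uvSum s ≤ 6·T(K)`. [this work] -/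
theorem unpaired_cell_ineq (hS : ∀ w, w ∈ S ↔ (w ≠ u ∧ w ≠ v ∧ w ≠ y ∧ K.mul y w ≠ 0)) (huv : u ≠ v) (hyu : y ≠ u) (hyv : y ≠ v)
    (hmy : K.mark y = 0) (hyu' : K.mul y u ≠ 0) (hv0 : K.mul y v = 0) (htwo : 2 ≤ S.card) :
    2 * (K.isolate y).TfunM u v + 2 * K.allZeroSum y S u v + 2 * K.blockSum y S u v + ∑ s ∈ S, K.uvSum y S s u v
      ≤ 6 * K.TfunM u v := by
  let u' : ({y}ᶜ : Set V) := ⟨u, Set.mem_compl_singleton_iff.mpr hyu.symm⟩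
  let v' : ({y}ᶜ : Set V) := ⟨v, Set.mem_compl_singleton_iff.mpr hyv.symm⟩
  have h1 := K.sum_resU2_eq y S u' v'
  have h2 := sum_resU2_nonneg hS huv hyu hyv hmy hyu' hv0 htwo
  dsimp only [u', v'] at h1
  rw [h1] at h2
  linarith

end UnpairedHeart

end MGraph

end Summit.CriticalPhenomena.PercolationContinuityZ3.Theorems.SunflowerPartition.Kempe
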